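import Literature.Probability.LatticeModels.IsingLaceEventLocality
import HarnessLib

/-!
# Sakai's second expansion, (2.29) → (2.31) and (2.34): the parity of the pivotal bond for pairs

Topic `Probability/LatticeModels`, grouping namespace `IsingLace`. Third file of the proof of the
second-expansion identity (2.35) of A. Sakai, *Lace expansion for the Ising model* (the tree's named
fact `IsingLace.Sakai2007_secondExpansion`). In the `b`-summand of (2.29), summed against the
weights `w_{𝒜ᶜ}(m) w_Λ(n)` with `∂m = ∅`, `∂n = v △ x`, "we have replaced '`m_b + n_b > 0`' by
'`m_b` even, `n_b` odd' that is the only possible combination consistent with the source constraints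
and the conditions in the indicators. As in (2.13), we alternate the parity of `n_b` by changing the
source constraint from `∂n = v △ x` to `∂n = v △ b △ x` and multiplying by `τ_b`" ((2.31)); and at
the end of the second stage "we can omit 'off `b`' and `1{m_b, n_b even}` using the source
constraints and the fact that `⟨φ_b̄ φ_x⟩_{𝒞^b_{m+n}(v)ᶜ} = 0` whenever `b̄ ∈ 𝒞^b_{m+n}(v)`"
((2.34)). Proved here, for the uniform coupling `β ≥ 0` on a finite graph (sums in `ℝ≥0∞`):

* `tsum_isFirstThrough_eq` — **(2.29) → (2.31) for the `n`-sum at frozen `m`** (`∂m = ∅`):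
  `Σ_{∂n = v△x} w(n) 1{b qualifies for m+n} = tanh β · Σ_{∂n = v△x△b̲△b̄, n_b even} w(n) 1{m_b even}
   1{E_{(m+n)∖b}(v,b̲;𝒜)} 1{b̄ ⟷_{m+n} x in 𝒞^b_{m+n}(v)ᶜ}` (the parities by the handshake lemmas of
  `IsingLaceEventLocality.lean`, the flip by the tree's `tsum_odd_eq_tanh_mul_tsum_even`), and its
  version summed over `m` against `1{m ⊆ 𝔹_{𝒜ᶜ}, ∂m = ∅} w(m)` (`tsum_pair_isFirstThrough_eq`);
* `indicator_drop₂` — **(2.33) → (2.34), pointwise** on `{∂m = ∅, ∂n = v △ b̲}`: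
  `1{n_b even}1{m_b even}1{E_{(m+n)∖b}(v,b̲;𝒜)} c ⟨φ_b̄φ_x⟩_{𝒞ᶜ} = 1{E_{m+n}(v,b̲;𝒜)} c ⟨φ_b̄φ_x⟩_{𝒞ᶜ}`,
  `𝒞 = 𝒞^b_{m+n}(v)`, any factor `c`.

## References

* A. Sakai, *Lace expansion for the Ising model*, Comm. Math. Phys. 272 (2007) 283–344,
  arXiv:math-ph/0510093: §2.2.2, (2.29)–(2.31) and (2.34) [Sakai2007].
(Equation numbers are those of the arXiv version held in the literature store, every display
counted.)
-/

noncomputable section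

open Finset
open scoped symmDiff ENNReal BigOperators

namespace Literature.Probability.LatticeModels

variable {V : Type*} [Fintype V] [DecidableEq V] {G : SimpleGraph V} [DecidableRel G.Adj]

namespace IsingLace

/-! ## `b̲ ∈ 𝒞^b(v)` from a connection across which `b` is the only exit -/

/-- If `b̄ ∉ 𝒞^b_N(v)` and `v ⟷_N b̲`, then `b̲ ∈ 𝒞^b_N(v)`: a walk from `v` can only leave the
cluster along `b`, from `b̲`. [folklore] -/
theorem fst_mem_clusterOff_of_conn {N : Current G} {d : G.Dart} {v : V}
    (hw : d.snd ∉ clusterOff G N (dartEdge G d) v) (h : Conn G N v d.fst) :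
    d.fst ∈ clusterOff G N (dartEdge G d) v := by
  by_contra hu
  obtain ⟨p⟩ := h
  obtain ⟨d₀, -, hd1, hd2⟩ := p.exists_boundary_dart (clusterOff G N (dartEdge G d) v : Set V)
    (Finset.mem_coe.2 (mem_clusterOff_self N _ v)) (fun h => hu (Finset.mem_coe.1 h))
  have he := clusterOff_cut N d v _ _ hd1 hd2 d₀.adj
  rcases Sym2.eq_iff.1 he with ⟨h1, -⟩ | ⟨h1, -⟩
  · exact hu (h1 ▸ Finset.mem_coe.1 hd1)
  · exact hw (h1 ▸ Finset.mem_coe.1 hd1)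

/-- `(m + n) ∖ b` only depends on `n ∖ b`. [folklore] -/
theorem update_add_update (m n : Current G) (b : G.edgeFinset) :
    Function.update (m + Function.update n b 0) b 0 = Function.update (m + n) b 0 := by
  funext e
  by_cases he : e = b
  · subst he
    rw [Function.update_self, Function.update_self]
  · rw [Function.update_of_ne he, Function.update_of_ne he, Pi.add_apply, Pi.add_apply,
      Function.update_of_ne he]

/-! ## (2.29) → (2.31): the parity of the pivotal bond and the `tanh` flip, for pairs -/

open Classical in
/-- **(2.29) → (2.31) at frozen `m`**: for `β ≥ 0`, `∂m = ∅` and a directed bond `b = (b̲, b̄)`,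
`Σ_{∂n = v△x} w(n) 1{b qualifies for m + n}`
`= tanh β · Σ_{∂n = v△x△b̲△b̄, n_b even} w(n) 1{m_b even} 1{E_{(m+n)∖b}(v,b̲;𝒜)} 1{b̄ ⟷_{m+n} x in 𝒞^b_{m+n}(v)ᶜ}`:
on the left `m_b` is even and `n_b` odd (handshake on `𝒞^b_{m+n}(v)`), and the two remaining
indicators do not see `n_b`. [cite: Sakai2007, (2.29)–(2.31)] -/
theorem tsum_isFirstThrough_eq {β : ℝ} (hβ : 0 ≤ β) {m : Current G} (hm : m.sources = ∅)
    (A : Finset V) (v x : V) (d : G.Dart) :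
    ∑' n : Current G, (if n.sources = ({v} : Finset V) ∆ {x} ∧ IsFirstThrough G (m + n) A v x d then
        ENNReal.ofReal (Current.weight β n) else 0) =
      ENNReal.ofReal (Real.tanh β) * ∑' n : Current G,
        (if n.sources = (({v} : Finset V) ∆ {x}) ∆ ({d.fst} ∆ {d.snd}) ∧ Even (n (dartEdge G d)) ∧
            Even (m (dartEdge G d)) ∧
              laceEvent G (Function.update (m + n) (dartEdge G d) 0) A v d.fst ∧
                ConnAvoid G (m + n) (clusterOff G (m + n) (dartEdge G d) v) d.snd x
          then ENNReal.ofReal (Current.weight β n) else 0) := by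
  classical
  have hb : ((dartEdge G d : G.edgeFinset) : Sym2 V) = s(d.fst, d.snd) := rfl
  set F : Current G → ℝ≥0∞ := fun n =>
    if Even (m (dartEdge G d)) ∧ laceEvent G (Function.update (m + n) (dartEdge G d) 0) A v d.fst ∧
        ConnAvoid G (m + n) (clusterOff G (m + n) (dartEdge G d) v) d.snd x then 1 else 0 with hF_def
  -- the two remaining indicators are blind to `n_b`
  have hF : ∀ n : Current G, F n = F (Function.update n (dartEdge G d) 0) := by
    intro n
    have h1 := laceEvent_and_connAvoid_update_iff (m + n) A v x d
    have h2 := laceEvent_and_connAvoid_update_iff (m + Function.update n (dartEdge G d) 0) A v x d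
    rw [update_add_update] at h2
    have key := h1.trans h2.symm
    simp only [hF_def]
    rw [update_add_update]
    by_cases hq : Even (m (dartEdge G d)) ∧
        laceEvent G (Function.update (m + n) (dartEdge G d) 0) A v d.fst ∧
          ConnAvoid G (m + n) (clusterOff G (m + n) (dartEdge G d) v) d.snd x
    · rw [if_pos hq, if_pos ⟨hq.1, key.1 hq.2⟩]
    · rw [if_neg hq, if_neg (fun h => hq ⟨h.1, key.2 h.2⟩)]
  have h := tsum_odd_eq_tanh_mul_tsum_even hβ (dartEdge G d) hb (({v} : Finset V) ∆ {x}) F hF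
  -- identification of the summands on the left: `m_b` even, `n_b` odd
  have hL : ∀ n : Current G, (if n.sources = ({v} : Finset V) ∆ {x} ∧ IsFirstThrough G (m + n) A v x d
      then ENNReal.ofReal (Current.weight β n) else 0) =
      (if n.sources = ({v} : Finset V) ∆ {x} ∧ Odd (n (dartEdge G d)) then
        ENNReal.ofReal (Current.weight β n) * F n else 0) := by
    intro n
    by_cases hsn : n.sources = ({v} : Finset V) ∆ {x}
    · have hiff : IsFirstThrough G (m + n) A v x d ↔ Odd (n (dartEdge G d)) ∧ (Even (m (dartEdge G d)) ∧
          laceEvent G (Function.update (m + n) (dartEdge G d) 0) A v d.fst ∧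
            ConnAvoid G (m + n) (clusterOff G (m + n) (dartEdge G d) v) d.snd x) := by
        constructor
        · intro hq
          exact ⟨odd_of_sources_eq_pair le_add_self hb hsn hq.notMem,
            even_of_sources_empty le_self_add hb hm hq.fst_mem hq.snd_notMem, hq.1, hq.2.2⟩
        · rintro ⟨hodd, -, hE, hav⟩
          exact ⟨hE, lt_of_lt_of_le hodd.pos ((le_add_self : n ≤ m + n) (dartEdge G d)), hav⟩
      simp only [hsn, true_and, hiff, hF_def]
      by_cases ho : Odd (n (dartEdge G d))
      · simp only [ho, true_and, if_true]
        split_ifs <;> simp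
      · simp [ho]
    · simp [hsn]
  have hR : ∀ n : Current G, (if n.sources = (({v} : Finset V) ∆ {x}) ∆ ({d.fst} ∆ {d.snd}) ∧
        Even (n (dartEdge G d)) ∧ Even (m (dartEdge G d)) ∧
          laceEvent G (Function.update (m + n) (dartEdge G d) 0) A v d.fst ∧
            ConnAvoid G (m + n) (clusterOff G (m + n) (dartEdge G d) v) d.snd x
        then ENNReal.ofReal (Current.weight β n) else 0) =
      (if n.sources = (({v} : Finset V) ∆ {x}) ∆ ({d.fst} ∆ {d.snd}) ∧ Even (n (dartEdge G d)) then
        ENNReal.ofReal (Current.weight β n) * F n else 0) := by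
    intro n
    simp only [hF_def]
    split_ifs <;> simp_all
  rw [tsum_congr hL, h, tsum_congr hR]

/-- Fubini with a factor depending on the first coordinate only (`ℝ≥0∞`). [folklore] -/
theorem tsum_prod_mul_left {α γ : Type*} (F₁ : α → ℝ≥0∞) (F₂ : α → γ → ℝ≥0∞) :
    ∑' p : α × γ, F₁ p.1 * F₂ p.1 p.2 = ∑' a, F₁ a * ∑' c, F₂ a c := by
  rw [ENNReal.tsum_prod']
  refine tsum_congr fun a => ?_
  dsimp only
  exact ENNReal.tsum_mul_left

open Classical in
/-- **(2.29) → (2.31), summed over the restricted current `m`** (weights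
`1{m ⊆ 𝔹_{𝒜ᶜ}, ∂m = ∅} w(m)`): the `b`-summand of the second expansion after the parity flip.
[cite: Sakai2007, (2.29)–(2.31)] -/
theorem tsum_pair_isFirstThrough_eq {β : ℝ} (hβ : 0 ≤ β) (A : Finset V) (v x : V) (d : G.Dart) :
    ∑' p : Current G × Current G,
        (if Current.IsSupp (offGraph G A) p.1 ∧ p.1.sources = ∅ then ENNReal.ofReal (p.1.weight β) else 0) *
          (if p.2.sources = ({v} : Finset V) ∆ {x} ∧ IsFirstThrough G (p.1 + p.2) A v x d then
            ENNReal.ofReal (p.2.weight β) else 0) =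
      ENNReal.ofReal (Real.tanh β) * ∑' p : Current G × Current G,
        (if Current.IsSupp (offGraph G A) p.1 ∧ p.1.sources = ∅ then ENNReal.ofReal (p.1.weight β) else 0) *
          (if p.2.sources = (({v} : Finset V) ∆ {x}) ∆ ({d.fst} ∆ {d.snd}) ∧ Even (p.2 (dartEdge G d)) ∧
              Even (p.1 (dartEdge G d)) ∧
                laceEvent G (Function.update (p.1 + p.2) (dartEdge G d) 0) A v d.fst ∧
                  ConnAvoid G (p.1 + p.2) (clusterOff G (p.1 + p.2) (dartEdge G d) v) d.snd x
            then ENNReal.ofReal (p.2.weight β) else 0) := by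
  have e1 := tsum_prod_mul_left
    (fun m : Current G => if Current.IsSupp (offGraph G A) m ∧ m.sources = ∅ then
      ENNReal.ofReal (m.weight β) else 0)
    (fun m n : Current G => if n.sources = ({v} : Finset V) ∆ {x} ∧ IsFirstThrough G (m + n) A v x d then
      ENNReal.ofReal (n.weight β) else 0)
  have e2 := tsum_prod_mul_left
    (fun m : Current G => if Current.IsSupp (offGraph G A) m ∧ m.sources = ∅ then
      ENNReal.ofReal (m.weight β) else 0)
    (fun m n : Current G => if n.sources = (({v} : Finset V) ∆ {x}) ∆ ({d.fst} ∆ {d.snd}) ∧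
        Even (n (dartEdge G d)) ∧ Even (m (dartEdge G d)) ∧
          laceEvent G (Function.update (m + n) (dartEdge G d) 0) A v d.fst ∧
            ConnAvoid G (m + n) (clusterOff G (m + n) (dartEdge G d) v) d.snd x
      then ENNReal.ofReal (n.weight β) else 0)
  rw [e1, e2, ← ENNReal.tsum_mul_left]
  refine tsum_congr fun m => ?_
  by_cases hmc : Current.IsSupp (offGraph G A) m ∧ m.sources = ∅
  · rw [if_pos hmc, tsum_isFirstThrough_eq hβ hmc.2 A v x d, mul_left_comm]
  · rw [if_neg hmc, zero_mul, zero_mul, mul_zero]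

/-! ## (2.33) → (2.34): dropping the parity constraints and "off `b`" -/

/-- **The passage (2.33) → (2.34), pointwise**: on `{∂m = ∅, ∂n = v △ b̲}`,
`1{n_b even} 1{m_b even} 1{E_{(m+n)∖b}(v,b̲;𝒜)} ⟨φ_b̄ φ_x⟩_{𝒞ᶜ} = 1{E_{m+n}(v,b̲;𝒜)} ⟨φ_b̄ φ_x⟩_{𝒞ᶜ}`
with `𝒞 = 𝒞^b_{m+n}(v)`: if `b̄ ∈ 𝒞` both sides vanish; if not, the parities hold by the handshake
and the event does not see `n_b`. [cite: Sakai2007, (2.33)–(2.34)] -/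
theorem indicator_drop₂ (β : ℝ) {m n : Current G} {d : G.Dart} {v : V} (A : Finset V) (x : V) (c : ℝ≥0∞)
    (hm : m.sources = ∅) (hs : n.sources = ({v} : Finset V) ∆ {d.fst})
    [Decidable (Even (n (dartEdge G d)) ∧ Even (m (dartEdge G d)) ∧
      laceEvent G (Function.update (m + n) (dartEdge G d) 0) A v d.fst)]
    [Decidable (laceEvent G (m + n) A v d.fst)] :
    (if Even (n (dartEdge G d)) ∧ Even (m (dartEdge G d)) ∧
        laceEvent G (Function.update (m + n) (dartEdge G d) 0) A v d.fst then
        c * ENNReal.ofReal (twoPointOff G β (clusterOff G (m + n) (dartEdge G d) v) d.snd x) else 0) =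
      (if laceEvent G (m + n) A v d.fst then
        c * ENNReal.ofReal (twoPointOff G β (clusterOff G (m + n) (dartEdge G d) v) d.snd x) else 0) := by
  have hb : ((dartEdge G d : G.edgeFinset) : Sym2 V) = s(d.fst, d.snd) := rfl
  by_cases hw : d.snd ∈ clusterOff G (m + n) (dartEdge G d) v
  · rw [twoPointOff_of_not β (fun h => h.1 hw), ENNReal.ofReal_zero, mul_zero, ite_self, ite_self]
  by_cases hu : d.fst ∈ clusterOff G (m + n) (dartEdge G d) v
  · have h1 : Even (n (dartEdge G d)) := even_of_sources_eq_pair le_add_self hb hs hw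
    have h2 : Even (m (dartEdge G d)) := even_of_sources_empty le_self_add hb hm hu hw
    simp only [h1, h2, true_and, laceEvent_update_iff hw hu]
  · have h1 : ¬laceEvent G (Function.update (m + n) (dartEdge G d) 0) A v d.fst := fun h => hu (by
      rw [clusterOff_eq, ← conn_iff_mem_cluster]; exact h.1.1)
    have h2 : ¬laceEvent G (m + n) A v d.fst := fun h => hu (fst_mem_clusterOff_of_conn hw h.1.1)
    rw [if_neg (fun h => h1 h.2.2), if_neg h2]

end IsingLace

end Literature.Probability.LatticeModels

end
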